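import Summits.QuantumFields.BalabanUV.T4Continuum.Support.AveragingDeficitDerivWallProof
import Summits.QuantumFields.BalabanUV.T4Continuum.Support.AveragingDeficitPeriodicCounting

/-!
# AveragingDeficitDerivWallPeriodic (T⁴ programme, node NE3, row NE3-R2, gen 2) — β-per, THE PERIODIC (TORUS) DERIVATIVE
# WALL OF THE NE3 ENERGY ROUTE, TYPED AND PROVED: `DeficitDerivWallPer d N L C a₀` and
# `deficitDerivWallPer_holds : 1 ≤ L → DeficitDerivWallPer d N L (wallConst d L) (1/(512(d+1)(d+4)L²))`; hence
# `ClaimBetaTorus d N L` (β-per ∧ β′-per) and the non-abelian residual pairing on the torus with β-per BY NAME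
# (file 2/2; file 1/2 `AveragingDeficitPeriodicCounting` is the torus counting)

HONEST FRAMING (cell `pub-balaban`, T4-DAG PAGE 1; unit `b2b-balaban-t4-ne3r2-p1` = owner of BINDER-OWNERS row NE3-R2,
gen 2).  The cell's T4 target is the finite-torus continuum limit of the unit-scale averaged loop expectations — NOT
infinite volume, NO mass gap, NOT Clay, NOT summit progress.  WHAT THIS FILE PROVES is the form of the derivative wall
that the torus consumer of NE3 instantiates BY NAME: session 1 proved β = `T4AveragingDeficitWall.DeficitDerivWall` on
`ℤ^d` for FINITELY SUPPORTED directions and all large windows (`AveragingDeficitDerivWallProof.deficitDerivWall_holds`);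
the minimisers and tangent directions of the energy route live on a finite torus (the B7/B11 modules periodise), where
directions are PERIODIC and the deficit is the FULL-PERIOD-WINDOW deficit of `T4AveragingDeficitWallBoundary.
DeficitValueWallPer`.  §1 TYPES β-per: for every `M ≥ 1`, every `U(N)`-valued `V` of period `L·M` in the small-field
class `SmallField V a`, `0 ≤ a ≤ a₀`, every `𝔲(N)`-valued direction `ψ` of period `L·M` and every derivative `D` of
`s ↦ 𝓓_{W([0,M)^d)}(V e^{sψ})` at `s = 0`,
`|D| ≤ C·[‖∇_V F‖_{ℓ²([0,LM)^d)}·‖d_Vψ‖_{ℓ²([0,LM)^d)} + a²(‖ψ‖_{ℓ¹([0,LM)^d)} + ‖d_Vψ‖_{ℓ¹([0,LM)^d)})]` — the SAME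
curl form as β with every norm over ONE FUNDAMENTAL DOMAIN and NO neighbourhood radius (the torus has no outside).
§2 PROVES `β-per ⇐ CoarseCore` (`deficitDerivWallPer_of_coarseCore`) by the torus re-run of
`AveragingDeficitDerivAssembly`: (i) the derivative on the period window is `L^{d−4}Σ_{P} t_P − Σ_{p} t′_p` (sum rule +
uniqueness); (ii) no eventuality / locality is needed (the window is fixed and finite); (iii) THE EXACT CANCELLATION of
the fine main term against the stencil diagonals on the torus (`AveragingDeficitPeriodicCounting.sum_stencilPair_eq_per`,
every fine plaquette of the torus in exactly `L²` stencils); (iv) the fine Wilson-weight pairing; (v) the torus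
dominations (S1p)–(S3p); the constant is the SAME `assemblyConst` as on `ℤ^d`.  §3 `deficitDerivWallPer_holds` from
`coarseCore_holds` (session 1; the per-plaquette core has no support hypothesis on `ψ`), monotonicity, `ClaimBetaTorus`
(β-per ∧ β′-per with common constants) and `claimBetaTorus_holds` (β′-per = tree `deficitValueWallPer_holds`); the wall
bounds an actual number (`DeficitDerivWallPer.deriv_bound`: the derivative exists throughout the small-field class,
tree `differentiableAt_deficit_vary`).  §4 THE NON-ABELIAN RESIDUAL PAIRING ON THE TORUS WITH β-per BY NAME
(`coarseDeriv_abs_le_of_fineCritical`): if the periodic `V` is critical for the fine Wilson action of the period along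
the periodic direction `ψ`, every derivative of the coarse Wilson action of the AVERAGED configuration along the induced
variation obeys `L^{d−4}|D_c| ≤ wallConst·[…]` — the coarse residual of the average of a fine-critical configuration is
of first order in the curvature-gradient level, the mechanism of the η-rate (`T4ConvexResponse.residual_pairing`,
here for Bałaban's non-linear non-abelian average (42)).  NE3 ITSELF IS NOT PROVED: on the energy route
NE3(A) ⇐ ML ∧ R0 ∧ β ∧ γ (record `t4/T4-EST-NE3-P2.md` §0 (e)); ML (tangent coercivity), R0 (admissibility), γ (tangent
lift), the δ dictionary remain exactly as recorded; NE3 stays COND-free (no BetaPertH / (B) / (B^μ)).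
CITATION HEADER: no printed sentence is a hypothesis; the manuscripts under audit are not cited for any disputed step;
context: T. Bałaban, Commun. Math. Phys. **98** (1985) 17–51 [Balaban1985Averaging] ((42), (44), (45) pp. 23–24),
**102** (1985) 277–309 [Balaban1985Variational] ((5) p. 278, (26)–(27) p. 282, §E (115)–(121) p. 295).  PLACEMENT:
`Summits/QuantumFields/BalabanUV/` (human rule 2026-08-19).  Record: HOME `t4/T4-EST-NE3-R2.md` v0.3.
-/

set_option autoImplicit false

open scoped BigOperators Matrix Matrix.Norms.L2Operator Topology
open NormedSpace Finset Filter

namespace Summit.QuantumFields.BalabanUV.T4Continuum.AveragingDeficitDerivWallPeriodic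

open Literature.MathematicalPhysics.QuantumFieldTheory.Balaban1983to89
open B7Prop1Explicit B7Prop2Explicit MatrixLog UnitaryModel
open T4AveragingDeficitWall hiding Site Plane Plaq Bond
open T4AveragingDeficitWallBoundary (stencilIdx stencilOff card_stencilIdx IsPeriodicCfg periodBox blockSites_periodBox
  DeficitValueWallPer)
open T4AveragingDeficitNonAbelian (small_a_le valueWallPer_mono deficitValueWallPer_holds wallConstNA wallConstNA_nonneg)
open AveragingDeficitTransport AveragingDeficitLocality AveragingDeficitNearIdentity AveragingDeficitCounting
open AveragingDeficitDerivCore AveragingDeficitDerivAssembly AveragingDeficitCoreAxial AveragingDeficitDerivWallProof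
open AveragingDeficitPeriodicCounting

noncomputable section

variable {d : ℕ} {n : Type*} [Fintype n] [DecidableEq n] [Nonempty n]

local notation "𝕄" => Matrix n n ℂ
local notation "Site" => B7Prop1Explicit.Site
local notation "Plane" => T4AveragingDeficitWall.Plane
local notation "Plaq" => T4AveragingDeficitWall.Plaq

/-! ## §1 β-per, typed -/

variable (d n) in
/-- **THE PERIODIC (TORUS) DERIVATIVE WALL β-per, TYPED**: for every `M ≥ 1`, every `U(N)`-valued `V` of period `L·M`
in the small-field class `SmallField V a`, `0 ≤ a ≤ a₀`, every `𝔲(N)`-valued direction `ψ` of period `L·M`, and every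
derivative `D` at `s = 0` of the full-period-window deficit `s ↦ 𝓓_{W([0,M)^d)}(V e^{sψ})`,
`|D| ≤ C · [ ‖∇_V F‖_{ℓ²(F)} · ‖d_V ψ‖_{ℓ²(F)} + a² (‖ψ‖_{ℓ¹(F)} + ‖d_V ψ‖_{ℓ¹(F)}) ]`, `F = [0,LM)^d` the block sites of one
fundamental domain — the curl form of β with no neighbourhood radius.  The derivative enters as a `HasDerivAt`
HYPOTHESIS (no junk value of `deriv`). [folklore] -/
def DeficitDerivWallPer (L : ℕ) (C a₀ : ℝ) : Prop :=
  ∀ (M : ℕ), 1 ≤ M →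
  ∀ (V : Site d → Fin d → 𝕄ˣ), IsUnitaryCfg V → IsPeriodicCfg V ((L : ℤ) * M) →
  ∀ (a : ℝ), 0 ≤ a → a ≤ a₀ → SmallField V a →
  ∀ (ψ : Site d → Fin d → 𝕄), IsSkewDir ψ → IsPeriodicDir ψ ((L : ℤ) * M) →
  ∀ D : ℝ, HasDerivAt (fun s : ℝ => deficit L (vary V ψ s) (blockWindow L (periodBox M))) D 0 →
    |D| ≤ C * (Real.sqrt (gradFluxSq V (blockSites L (periodBox M))) * Real.sqrt (curlSq V ψ (blockSites L (periodBox M)))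
      + a ^ 2 * (dirL1 ψ (blockSites L (periodBox M)) + curlL1 V ψ (blockSites L (periodBox M))))

omit [Nonempty n] in
/-- Monotonicity of β-per in the constants. [folklore] -/
theorem DeficitDerivWallPer.mono {L : ℕ} {C C' a₀ a₀' : ℝ} (hC : C ≤ C') (ha₀ : a₀' ≤ a₀)
    (h : DeficitDerivWallPer d n L C a₀) : DeficitDerivWallPer d n L C' a₀' := by
  intro M hM V hV hP a ha haa hVa ψ hψ hψP D hD
  refine (h M hM V hV hP a ha (haa.trans ha₀) hVa ψ hψ hψP D hD).trans ?_
  have h1 : 0 ≤ dirL1 ψ (blockSites L (periodBox (d := d) M)) := dirL1_nonneg _ _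
  have h2 : 0 ≤ curlL1 V ψ (blockSites L (periodBox (d := d) M)) :=
    Finset.sum_nonneg fun _ _ => Finset.sum_nonneg fun _ _ => norm_nonneg _
  exact mul_le_mul_of_nonneg_right hC (by positivity)

/-! ## §2 β-per ⇐ CoarseCore: the torus assembly -/

/-- Real bookkeeping for the last step of the assembly (same shape as on `ℤ^d`). [folklore] -/
private theorem assembly_aux {Lp c₁ c₂ S K₁ L2 Q a2 dir cur C : ℝ} (hQ : 0 ≤ Q) (hdir : 0 ≤ a2 * dir)
    (hcur : 0 ≤ a2 * cur) (hC1 : Lp * c₁ * S ≤ C) (hC2 : Lp * c₂ * K₁ ≤ C) (hC3 : Lp * c₂ * L2 + 4 ≤ C) :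
    Lp * (c₁ * (S * Q) + c₂ * a2 * (K₁ * dir + L2 * cur)) + 4 * a2 * cur ≤ C * (Q + a2 * (dir + cur)) := by
  have e : Lp * (c₁ * (S * Q) + c₂ * a2 * (K₁ * dir + L2 * cur)) + 4 * a2 * cur
      = (Lp * c₁ * S) * Q + (Lp * c₂ * K₁) * (a2 * dir) + (Lp * c₂ * L2 + 4) * (a2 * cur) := by ring
  rw [e]
  have h1 := mul_le_mul_of_nonneg_right hC1 hQ
  have h2 := mul_le_mul_of_nonneg_right hC2 hdir
  have h3 := mul_le_mul_of_nonneg_right hC3 hcur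
  have e2 : C * (Q + a2 * (dir + cur)) = C * Q + C * (a2 * dir) + C * (a2 * cur) := by ring
  rw [e2]
  linarith

set_option maxHeartbeats 1600000 in
/-- **β-per ⇐ CoarseCore**: the periodic derivative wall follows, with the SAME explicit constant `assemblyConst` as
β on `ℤ^d`, from the per-plaquette core estimate summed with torus counting.  [folklore] -/
theorem deficitDerivWallPer_of_coarseCore (L : ℕ) (hL : 1 ≤ L) {c₁ c₂ a₀ : ℝ} {Rb : ℕ} (hc₁ : 0 ≤ c₁) (hc₂ : 0 ≤ c₂)
    (ha₀ : 512 * (d + 1) * (d + 4) * (L : ℝ) ^ 2 * a₀ ≤ 1) (hcore : CoarseCore d n L c₁ c₂ a₀ Rb) :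
    DeficitDerivWallPer d n L (assemblyConst d L c₁ c₂ Rb) a₀ := by
  intro M hM V hV hVP a ha haa₀ hVa ψ hψ hψP D hD
  -- smallness bookkeeping
  have hK : (0 : ℝ) ≤ 512 * (d + 1) * (d + 4) * (L : ℝ) ^ 2 := by positivity
  have hsmall : 512 * (d + 1) * (d + 4) * (L : ℝ) ^ 2 * a ≤ 1 := (mul_le_mul_of_nonneg_left haa₀ hK).trans ha₀
  have hL0 : (0 : ℝ) < L := by exact_mod_cast hL
  have ha1 : a ≤ 1 / 4 := by
    have h1 : (4 : ℝ) ≤ ((d : ℝ) + 1) * ((d : ℝ) + 4) * (L : ℝ) ^ 2 := by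
      have hd0 : (0 : ℝ) ≤ d := Nat.cast_nonneg d
      have hL1 : (1 : ℝ) ≤ (L : ℝ) ^ 2 := one_le_pow₀ (by exact_mod_cast hL)
      have h1' : (4 : ℝ) ≤ ((d : ℝ) + 1) * ((d : ℝ) + 4) := by nlinarith
      calc (4 : ℝ) = 4 * 1 := by ring
        _ ≤ ((d : ℝ) + 1) * ((d : ℝ) + 4) * (L : ℝ) ^ 2 := mul_le_mul h1' hL1 (by norm_num) (by positivity)
    have h2 := mul_le_mul_of_nonneg_right h1 ha
    have e : ((d : ℝ) + 1) * ((d : ℝ) + 4) * (L : ℝ) ^ 2 * a = (512 * (d + 1) * (d + 4) * (L : ℝ) ^ 2 * a) / 512 := by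
      ring
    rw [e] at h2
    linarith
  -- the two halves of the period window and the fundamental domain
  set Wc : Finset (Plaq d) := periodBox M ×ˢ (Finset.univ : Finset (Plane d)) with hWc_def
  set N : Finset (Site d) := blockSites L (periodBox M) with hN_def
  set Wf : Finset (Plaq d) := N ×ˢ (Finset.univ : Finset (Plane d)) with hWf_def
  have hW : blockWindow L (periodBox (d := d) M) = (Wc, Wf) := rfl
  have hNeq : N = periodBox (L * M) := blockSites_periodBox L M hL
  -- the loop variables are in the ball: derivatives exist
  have hball : ∀ (q : Site d) (κ : Fin d) (r : Fin d → Fin L), ‖((Wcx L V q κ (boxVec L r) : 𝕄ˣ) : 𝕄) - 1‖ < 1 :=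
    norm_Wcx_sub_one_lt_one_of_smallField L hL hV ha hsmall hVa
  -- the per-plaquette coarse derivatives and the fine derivatives
  have ht : ∀ P : Plaq d, HasDerivAt (fun s : ℝ => wt (chol L (vary V ψ s) P))
      (deriv (fun s : ℝ => wt (chol L (vary V ψ s) P)) 0) 0 := fun P =>
    (differentiableAt_wt_comp (differentiableAt_val_chol_vary L V ψ P hball)).hasDerivAt
  have ht' : ∀ p : Plaq d, HasDerivAt (fun s : ℝ => wt (fhol (vary V ψ s) p))
      (-nReTr (curl V ψ p * ((fhol V p : 𝕄ˣ) : 𝕄))) 0 := fun p => hasDerivAt_wt_fhol_vary V ψ p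
  -- (i) the derivative as a sum
  have hD' : HasDerivAt (fun s : ℝ => deficit L (vary V ψ s) (blockWindow L (periodBox M)))
      ((L : ℝ) ^ ((d : ℤ) - 4) * ∑ P ∈ Wc, deriv (fun s : ℝ => wt (chol L (vary V ψ s) P)) 0
        - ∑ p ∈ Wf, -nReTr (curl V ψ p * ((fhol V p : 𝕄ˣ) : 𝕄))) 0 := by
    have h1 := HasDerivAt.fun_sum (u := Wc) fun P _ => ht P
    have h2 := HasDerivAt.fun_sum (u := Wf) fun p _ => ht' p
    have h := (h1.const_mul ((L : ℝ) ^ ((d : ℤ) - 4))).sub h2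
    refine h.congr_of_eventuallyEq (Filter.Eventually.of_forall fun s => ?_)
    rw [hW]
    simp only [deficit, coarseAction, fineAction, Pi.sub_apply]
  have hDeq := hD.unique hD'
  -- (iii) the exact cancellation on the torus
  have hcancel : ∑ P ∈ Wc, stencilPair L V ψ P.1 P.2 = (L : ℝ) ^ 2 * ∑ p ∈ Wf, nReTr (curl V ψ p * flux V p) := by
    rw [hWc_def, hWf_def, hNeq]
    exact sum_stencilPair_eq_per L M hL hM hVP hψP
  have hzpow : (L : ℝ) ^ ((d : ℤ) - 4) * (L : ℝ) ^ ((2 : ℤ) - d) * (L : ℝ) ^ 2 = 1 := by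
    rw [← zpow_add₀ hL0.ne', show ((d : ℤ) - 4) + (2 - d) = -2 by ring, ← zpow_natCast (L : ℝ) 2,
      ← zpow_add₀ hL0.ne']
    norm_num
  have hDeq2 : D = (L : ℝ) ^ ((d : ℤ) - 4) * ∑ P ∈ Wc,
        (deriv (fun s : ℝ => wt (chol L (vary V ψ s) P)) 0 + (L : ℝ) ^ ((2 : ℤ) - d) * stencilPair L V ψ P.1 P.2)
      + ∑ p ∈ Wf, (nReTr (curl V ψ p * ((fhol V p : 𝕄ˣ) : 𝕄)) - nReTr (curl V ψ p * mlog ((fhol V p : 𝕄ˣ) : 𝕄))) := by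
    rw [hDeq, Finset.sum_add_distrib, ← Finset.mul_sum, hcancel, Finset.sum_sub_distrib,
      Finset.sum_neg_distrib, mul_add, ← mul_assoc, ← mul_assoc, hzpow, one_mul]
    simp only [flux]
    ring
  -- (iv) termwise bounds
  have hcoarse : ∀ P ∈ Wc,
      |deriv (fun s : ℝ => wt (chol L (vary V ψ s) P)) 0 + (L : ℝ) ^ ((2 : ℤ) - d) * stencilPair L V ψ P.1 P.2|
      ≤ c₁ * stencilCurlL1 L V ψ P.1 P.2 * boxGradL1 L V Rb P.1 P.2
        + c₂ * a ^ 2 * (dirL1 ψ (box Rb ((L : ℤ) • P.1)) + stencilCurlL1 L V ψ P.1 P.2) := fun P _ =>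
    hcore V hV a ha haa₀ hVa ψ hψ P.1 P.2 _ (ht P)
  have hfine : ∀ p ∈ Wf, |nReTr (curl V ψ p * ((fhol V p : 𝕄ˣ) : 𝕄)) - nReTr (curl V ψ p * mlog ((fhol V p : 𝕄ˣ) : 𝕄))|
      ≤ 4 * a ^ 2 * ‖curl V ψ p‖ := by
    rintro ⟨x, π⟩ _
    have hp : ‖((fhol V (x, π) : 𝕄ˣ) : 𝕄) - 1‖ ≤ a := hVa x π.1.1 π.1.2 (ne_of_lt π.2)
    have hsq : ‖((fhol V (x, π) : 𝕄ˣ) : 𝕄) - 1‖ ^ 2 ≤ a ^ 2 := pow_le_pow_left₀ (norm_nonneg _) hp 2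
    calc _ ≤ 4 * ‖((fhol V (x, π) : 𝕄ˣ) : 𝕄) - 1‖ ^ 2 * ‖curl V ψ (x, π)‖ :=
          abs_nReTr_mul_sub_mul_mlog_le (curl_mem_skewAdjoint hV hψ (x, π)) (hp.trans ha1)
      _ ≤ 4 * a ^ 2 * ‖curl V ψ (x, π)‖ :=
          mul_le_mul_of_nonneg_right (mul_le_mul_of_nonneg_left hsq (by norm_num)) (norm_nonneg _)
  -- (v) the summed right-hand sides against the wall functionals on the fundamental domain `N`
  have hS3 := sum_stencilCurl_mul_boxGrad_le_per L M hL hM Rb hVP hψP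
  have hS1 := sum_dirL1_box_le_per L M hL hM Rb (n := n) hψP
  have hS2 := sum_stencilCurlL1_eq_per L M hL hM hVP hψP
  rw [← hNeq] at hS3 hS1 hS2
  set Sroot : ℝ := Real.sqrt ((L : ℝ) ^ (d + 4) * (((2 * Rb + 1 : ℕ) : ℝ) ^ (2 * d) * d)) with hSroot_def
  set K₁ : ℝ := (Fintype.card (T4AveragingDeficitWall.Plane d) : ℝ) * (2 * Rb + 1) ^ d with hK₁_def
  set Q : ℝ := Real.sqrt (gradFluxSq V N) * Real.sqrt (curlSq V ψ N) with hQ_def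
  have hQ : 0 ≤ Q := mul_nonneg (Real.sqrt_nonneg _) (Real.sqrt_nonneg _)
  have hdir : 0 ≤ dirL1 ψ N := dirL1_nonneg ψ N
  have hcur : 0 ≤ curlL1 V ψ N := Finset.sum_nonneg fun _ _ => Finset.sum_nonneg fun _ _ => norm_nonneg _
  have hX : ∑ P ∈ Wc, stencilCurlL1 L V ψ P.1 P.2 * boxGradL1 L V Rb P.1 P.2 ≤ Sroot * Q := by
    rw [hWc_def, Finset.sum_product]
    refine hS3.trans (le_of_eq ?_)
    rw [Real.sqrt_mul (show (0 : ℝ) ≤ (L : ℝ) ^ (d + 4) by positivity) (curlSq V ψ N),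
      Real.sqrt_mul (show (0 : ℝ) ≤ ((2 * Rb + 1 : ℕ) : ℝ) ^ (2 * d) * d by positivity) (gradFluxSq V N),
      hSroot_def, Real.sqrt_mul (show (0 : ℝ) ≤ (L : ℝ) ^ (d + 4) by positivity)]
    ring
  have hY : ∑ P ∈ Wc, (dirL1 ψ (box Rb ((L : ℤ) • P.1)) + stencilCurlL1 L V ψ P.1 P.2)
      ≤ K₁ * dirL1 ψ N + (L : ℝ) ^ 2 * curlL1 V ψ N := by
    rw [hWc_def, Finset.sum_product]
    simp only [Finset.sum_add_distrib]
    exact add_le_add hS1 hS2.le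
  have hZ : ∑ p ∈ Wf, 4 * a ^ 2 * ‖curl V ψ p‖ = 4 * a ^ 2 * curlL1 V ψ N := by
    rw [← Finset.mul_sum, hWf_def]
    unfold T4AveragingDeficitWall.curlL1
    rw [Finset.sum_product]
  have hsumP : ∑ P ∈ Wc, (c₁ * stencilCurlL1 L V ψ P.1 P.2 * boxGradL1 L V Rb P.1 P.2
        + c₂ * a ^ 2 * (dirL1 ψ (box Rb ((L : ℤ) • P.1)) + stencilCurlL1 L V ψ P.1 P.2))
      ≤ c₁ * (Sroot * Q) + c₂ * a ^ 2 * (K₁ * dirL1 ψ N + (L : ℝ) ^ 2 * curlL1 V ψ N) := by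
    have e1 : ∀ P : Plaq d, c₁ * stencilCurlL1 L V ψ P.1 P.2 * boxGradL1 L V Rb P.1 P.2
        + c₂ * a ^ 2 * (dirL1 ψ (box Rb ((L : ℤ) • P.1)) + stencilCurlL1 L V ψ P.1 P.2)
        = c₁ * (stencilCurlL1 L V ψ P.1 P.2 * boxGradL1 L V Rb P.1 P.2)
          + (c₂ * a ^ 2) * (dirL1 ψ (box Rb ((L : ℤ) • P.1)) + stencilCurlL1 L V ψ P.1 P.2) := fun P => by ring
    rw [Finset.sum_congr rfl fun P _ => e1 P, Finset.sum_add_distrib, ← Finset.mul_sum, ← Finset.mul_sum]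
    exact add_le_add (mul_le_mul_of_nonneg_left hX hc₁) (mul_le_mul_of_nonneg_left hY (mul_nonneg hc₂ (sq_nonneg a)))
  -- (vi) assemble
  have hLpow : (0 : ℝ) < (L : ℝ) ^ ((d : ℤ) - 4) := zpow_pos hL0 _
  have hPabs : |(L : ℝ) ^ ((d : ℤ) - 4) * ∑ P ∈ Wc,
        (deriv (fun s : ℝ => wt (chol L (vary V ψ s) P)) 0 + (L : ℝ) ^ ((2 : ℤ) - d) * stencilPair L V ψ P.1 P.2)|
      ≤ (L : ℝ) ^ ((d : ℤ) - 4) * (c₁ * (Sroot * Q) + c₂ * a ^ 2 * (K₁ * dirL1 ψ N + (L : ℝ) ^ 2 * curlL1 V ψ N)) := by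
    rw [abs_mul, abs_of_pos hLpow]
    exact mul_le_mul_of_nonneg_left
      ((Finset.abs_sum_le_sum_abs _ _).trans ((Finset.sum_le_sum hcoarse).trans hsumP)) hLpow.le
  have hFabs : |∑ p ∈ Wf, (nReTr (curl V ψ p * ((fhol V p : 𝕄ˣ) : 𝕄)) - nReTr (curl V ψ p * mlog ((fhol V p : 𝕄ˣ) : 𝕄)))|
      ≤ 4 * a ^ 2 * curlL1 V ψ N :=
    (Finset.abs_sum_le_sum_abs _ _).trans ((Finset.sum_le_sum hfine).trans hZ.le)
  have hSroot : 0 ≤ Sroot := Real.sqrt_nonneg _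
  have hK₁ : 0 ≤ K₁ := by positivity
  have hC1 : (L : ℝ) ^ ((d : ℤ) - 4) * c₁ * Sroot ≤ assemblyConst d L c₁ c₂ Rb := by
    unfold assemblyConst
    have : 0 ≤ (L : ℝ) ^ ((d : ℤ) - 4) * (c₂ * (K₁ + (L : ℝ) ^ 2)) := by positivity
    nlinarith
  have hC2 : (L : ℝ) ^ ((d : ℤ) - 4) * c₂ * K₁ ≤ assemblyConst d L c₁ c₂ Rb := by
    unfold assemblyConst
    have h1 : 0 ≤ (L : ℝ) ^ ((d : ℤ) - 4) * (c₁ * Sroot) := by positivity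
    have h2 : 0 ≤ (L : ℝ) ^ ((d : ℤ) - 4) * (c₂ * (L : ℝ) ^ 2) := by positivity
    nlinarith
  have hC3 : (L : ℝ) ^ ((d : ℤ) - 4) * c₂ * (L : ℝ) ^ 2 + 4 ≤ assemblyConst d L c₁ c₂ Rb := by
    unfold assemblyConst
    have h1 : 0 ≤ (L : ℝ) ^ ((d : ℤ) - 4) * (c₁ * Sroot) := by positivity
    have h2 : 0 ≤ (L : ℝ) ^ ((d : ℤ) - 4) * (c₂ * K₁) := by positivity
    nlinarith
  rw [hDeq2]
  refine (abs_add_le _ _).trans ((add_le_add hPabs hFabs).trans ?_)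
  exact assembly_aux hQ (by positivity) (by positivity) hC1 hC2 hC3

/-! ## §3 β-per holds; `ClaimBetaTorus`; the wall bounds an actual number -/

/-- **β-per — THE PERIODIC DERIVATIVE WALL OF THE NE3 ENERGY ROUTE — IS A THEOREM**: for every `L ≥ 1`, `d`, `N ≥ 1`,
`DeficitDerivWallPer d N L (wallConst d L) (1/(512(d+1)(d+4)L²))` (same constants as β, session 1). [folklore] -/
theorem deficitDerivWallPer_holds (L : ℕ) (hL : 1 ≤ L) :
    DeficitDerivWallPer d n L (wallConst d L) (1 / (512 * (d + 1) * (d + 4) * (L : ℝ) ^ 2)) := by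
  have hK : (0 : ℝ) < 512 * (d + 1) * (d + 4) * (L : ℝ) ^ 2 := by
    have hL0 : (0 : ℝ) < L := by exact_mod_cast hL
    positivity
  exact deficitDerivWallPer_of_coarseCore L hL (coreC_nonneg d L).1 (coreC_nonneg d L).2
    (le_of_eq (mul_one_div_cancel hK.ne')) (coarseCore_holds L hL)

variable (d n) in
/-- **CLAIM β ON THE TORUS — β-per ∧ β′-per as ONE typed statement**: there are constants `C ≥ 0`, `0 < a₀ ≤ 1`,
depending on `d`, `N`, `L` only, for which both periodic walls hold (the derivative wall `DeficitDerivWallPer` of this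
file and the value wall `DeficitValueWallPer` of `T4AveragingDeficitWallBoundary`).  This is the shape the torus consumer
of the energy route instantiates BY NAME. [folklore] -/
def ClaimBetaTorus (L : ℕ) : Prop :=
  ∃ C a₀ : ℝ, 0 ≤ C ∧ 0 < a₀ ∧ a₀ ≤ 1 ∧ DeficitDerivWallPer d n L C a₀ ∧ DeficitValueWallPer d n L C a₀

/-- **`ClaimBetaTorus d N L` HOLDS** for `L ≥ 1`, with `C = max(wallConst, wallConstNA)` and `a₀ = 1/(512(d+1)(d+4)L²)`:
β-per is `deficitDerivWallPer_holds`, β′-per is the tree's `deficitValueWallPer_holds`. [folklore] -/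
theorem claimBetaTorus_holds (L : ℕ) (hL : 1 ≤ L) : ClaimBetaTorus d n L := by
  have hL0 : (0 : ℝ) < L := by exact_mod_cast hL
  have hK : (0 : ℝ) < 512 * (d + 1) * (d + 4) * (L : ℝ) ^ 2 := by positivity
  refine ⟨max (wallConst d L) (wallConstNA d L), 1 / (512 * (d + 1) * (d + 4) * (L : ℝ) ^ 2),
    (wallConst_nonneg d L).trans (le_max_left _ _), one_div_pos.mpr hK, ?_,
    (deficitDerivWallPer_holds L hL).mono (le_max_left _ _) le_rfl,
    valueWallPer_mono (le_max_right _ _) le_rfl (deficitValueWallPer_holds L hL)⟩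
  rw [div_le_one hK]
  exact one_le_smallConst L hL

/-- Inside the small-field class the full-period-window deficit IS differentiable along every periodic variation
`V e^{sψ}` (every loop variable of (42) lies in the analyticity ball of the logarithm; tree
`differentiableAt_deficit_vary`): the derivative hypothesis of β-per is instantiated by the actual derivative. [folklore] -/
theorem hasDerivAt_deficit_vary_per (L : ℕ) (hL : 1 ≤ L) {V : Site d → Fin d → 𝕄ˣ} (hV : IsUnitaryCfg V)
    {a : ℝ} (ha : 0 ≤ a) (hsmall : 512 * (d + 1) * (d + 4) * (L : ℝ) ^ 2 * a ≤ 1) (hVa : SmallField V a)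
    (ψ : Site d → Fin d → 𝕄) (M : ℕ) :
    HasDerivAt (fun s : ℝ => deficit L (vary V ψ s) (blockWindow L (periodBox M)))
      (deriv (fun s : ℝ => deficit L (vary V ψ s) (blockWindow L (periodBox M))) 0) 0 :=
  (differentiableAt_deficit_vary L V ψ _ (norm_Wcx_sub_one_lt_one_of_smallField L hL hV ha hsmall hVa)).hasDerivAt

/-- **β-per BOUNDS THE ACTUAL DERIVATIVE**: under `DeficitDerivWallPer d N L C a₀` with `a₀ ≤ 1/(512(d+1)(d+4)L²)`, for
every admissible periodic datum the definite number `deriv (s ↦ 𝓓_{W([0,M)^d)}(V e^{sψ})) 0` obeys the wall. [folklore] -/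
theorem DeficitDerivWallPer.deriv_bound {L : ℕ} (hL : 1 ≤ L) {C a₀ : ℝ} (hβ : DeficitDerivWallPer d n L C a₀)
    (ha₀ : 512 * (d + 1) * (d + 4) * (L : ℝ) ^ 2 * a₀ ≤ 1) {M : ℕ} (hM : 1 ≤ M) {V : Site d → Fin d → 𝕄ˣ}
    (hV : IsUnitaryCfg V) (hVP : IsPeriodicCfg V ((L : ℤ) * M)) {a : ℝ} (ha : 0 ≤ a) (haa₀ : a ≤ a₀)
    (hVa : SmallField V a) {ψ : Site d → Fin d → 𝕄} (hψ : IsSkewDir ψ) (hψP : IsPeriodicDir ψ ((L : ℤ) * M)) :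
    |deriv (fun s : ℝ => deficit L (vary V ψ s) (blockWindow L (periodBox M))) 0|
      ≤ C * (Real.sqrt (gradFluxSq V (blockSites L (periodBox M))) * Real.sqrt (curlSq V ψ (blockSites L (periodBox M)))
        + a ^ 2 * (dirL1 ψ (blockSites L (periodBox M)) + curlL1 V ψ (blockSites L (periodBox M)))) := by
  have hK : (0 : ℝ) ≤ 512 * (d + 1) * (d + 4) * (L : ℝ) ^ 2 := by positivity
  have hsmall : 512 * (d + 1) * (d + 4) * (L : ℝ) ^ 2 * a ≤ 1 := (mul_le_mul_of_nonneg_left haa₀ hK).trans ha₀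
  exact hβ M hM V hV hVP a ha haa₀ hVa ψ hψ hψP _ (hasDerivAt_deficit_vary_per L hL hV ha hsmall hVa ψ M)

/-! ## §4 The non-abelian residual pairing on the torus, with β-per BY NAME -/

/-- **THE COARSE RESIDUAL OF THE AVERAGE OF A FINE-CRITICAL CONFIGURATION** (the mechanism of the η-rate,
`T4ConvexResponse.residual_pairing`, for Bałaban's non-linear non-abelian average (42) on the torus): if the periodic
small-field `V` is CRITICAL for the fine Wilson action of the period along the periodic direction `ψ`
(`d/ds|₀ A_{[0,LM)^d}(V e^{sψ}) = 0`), then every derivative `D_c` at `0` of the coarse Wilson action of the AVERAGED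
configuration `s ↦ A_{[0,M)^d}(\overline{V e^{sψ}})` obeys
`L^{d−4}·|D_c| ≤ wallConst·[‖∇_V F‖_{ℓ²}‖d_Vψ‖_{ℓ²} + a²(‖ψ‖_{ℓ¹} + ‖d_Vψ‖_{ℓ¹})]` on the fundamental domain — the
residual is of FIRST ORDER in the curvature-gradient level.  Dictionary: `V = U_{k+1}(V′)` (critical along the fine
directions tangent to its constraints), `D_c = ⟨J(\overline{V}), δ\overline{V}⟩` [cite: Balaban1985Variational, (26)–(27) p.282]. [folklore] -/
theorem coarseDeriv_abs_le_of_fineCritical (L : ℕ) (hL : 1 ≤ L) {M : ℕ} (hM : 1 ≤ M) {V : Site d → Fin d → 𝕄ˣ}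
    (hV : IsUnitaryCfg V) (hVP : IsPeriodicCfg V ((L : ℤ) * M)) {a : ℝ} (ha : 0 ≤ a)
    (haa₀ : a ≤ 1 / (512 * (d + 1) * (d + 4) * (L : ℝ) ^ 2)) (hVa : SmallField V a) {ψ : Site d → Fin d → 𝕄}
    (hψ : IsSkewDir ψ) (hψP : IsPeriodicDir ψ ((L : ℤ) * M))
    (hcrit : HasDerivAt (fun s : ℝ => fineAction (vary V ψ s) (blockWindow L (periodBox M)).2) 0 0) {Dc : ℝ}
    (hDc : HasDerivAt (fun s : ℝ => coarseAction L (vary V ψ s) (blockWindow L (periodBox M)).1) Dc 0) :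
    (L : ℝ) ^ ((d : ℤ) - 4) * |Dc|
      ≤ wallConst d L * (Real.sqrt (gradFluxSq V (blockSites L (periodBox M)))
          * Real.sqrt (curlSq V ψ (blockSites L (periodBox M)))
        + a ^ 2 * (dirL1 ψ (blockSites L (periodBox M)) + curlL1 V ψ (blockSites L (periodBox M)))) := by
  have hL0 : (0 : ℝ) < L := by exact_mod_cast hL
  have hD : HasDerivAt (fun s : ℝ => deficit L (vary V ψ s) (blockWindow L (periodBox M)))
      ((L : ℝ) ^ ((d : ℤ) - 4) * Dc - 0) 0 := by
    have h := (hDc.const_mul ((L : ℝ) ^ ((d : ℤ) - 4))).sub hcrit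
    refine h.congr_of_eventuallyEq (Filter.Eventually.of_forall fun s => ?_)
    simp only [deficit, Pi.sub_apply]
  have key := deficitDerivWallPer_holds (d := d) (n := n) L hL M hM V hV hVP a ha haa₀ hVa ψ hψ hψP _ hD
  rw [sub_zero, abs_mul, abs_of_pos (zpow_pos hL0 _)] at key
  exact key

end

end Summit.QuantumFields.BalabanUV.T4Continuum.AveragingDeficitDerivWallPeriodic
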